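import Literature.RepresentationTheory.Kovacevic2021.SU21PrincipalSeriesReducibility
import Literature.RepresentationTheory.Kovacevic2021.SU21VertexRigidity
import HarnessLib

/-!
# Live walks inside a cell of Kovačević's principal series `V(c, 2t)`

Continuation of `…Kovacevic2021.SU21PrincipalSeriesReducibility` (the live arrows of `V(c,2t)` in the cone
coordinates `(p,q) ↦ V_{1+p+q, 2t+3p−3q}`: `A : (p,q) → (p+1,q)` live iff `a(p) ≠ 0`, `B : (p,q) → (p,q+1)` live iff
`b(q) ≠ 0`, `C : (p,q) → (p,q−1)` live iff `q ≥ 1`, `D : (p,q) → (p−1,q)` live iff `p ≥ 1`) and of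
`…SU21ArrowReversal` / `…SU21VertexRigidity` (live steps `Step`, reachability `Reach`, `casimirScalar_eq_zero_of_casimir_eq_zero`) [Kovacevic2021, §3 Thm 3, Remark 6].

Source [Kovacevic2021, §3 proof of Thm 3, held text p0007–p0008]: the `K`-types of a submodule of `V(c,2t)` form "a
cone", "a strip" or "a parallelogram" cut out by the root lines of `a` and `b`, and inside such a region one can
"walk from one vertex to another".  This file proves the walking statement in the form needed for the composition
factors (`SU21PrincipalSeriesCompositionFactors`): **inside a product cell `{(p,q) : p ∈ I, q ∈ J}` (`I`, `J`
order-connected sets of naturals) on which no internal `A`- or `B`-arrow dies, any `K`-type is reached from any other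
by live steps of `V(c,2t)` that stay in the cell** — a staircase walk: first along the row (`A`-steps up or
`D`-steps down), then along the column (`B` up or `C` down).  The statement is relative to an auxiliary datum `𝒟'`
whose live steps include the live steps of `V(c,2t)` inside a set `T ⊇` cell (for the subquotient data of
`SU21SubquotientData`, `T = sqSet` and this is `step_subquotient`), so that the conclusion is directly `𝒟'.Reach`.

Also (§3): the Casimir of `V(c,2t)` vanishes on the cohomological parabola `6c + t² = 0`, in particular for
`V(0,0)`, `V(−3/2, 6)`, `V(−3/2, −6)` (`casimirScalar` form, as consumed by `SU21ModelRecognition`).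

## What is here (theorems only; no definitions, no named facts)

`principalSeries_step_A/B/C/D` (one live step in cone coordinates), `reach_row_up`, `reach_row_down`,
`reach_col_up`, `reach_col_down`, **`reach_of_cell`** (§2), `principalSeries_casimir_eq_zero`,
`principalSeries_casimirScalar_eq_zero` and the three cohomological instances (§3).

## References

* D. Kovačević, *Unitary `(𝔤,K)` modules of `SU(2,1)`*, Acta Math. Spalatensia 1 (2021) 105–125
  (arXiv:1810.01752): §3 Thm 3 and its proof, Remark 6. [Kovacevic2021]
* A. Borel, N. Wallach (2000), VI 4.10 (10) p. 132. [BorelWallach2000]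
-/

noncomputable section

namespace Literature.RepresentationTheory.Kovacevic2021

namespace SU21Datum

open PrincipalSeries

variable (c : ℂ) (t : ℤ)

/-! ## §1 One live step of `V(c,2t)` in cone coordinates -/

/-- the live `A`-step `(p,q) → (p+1,q)` of `V(c,2t)` when `a(p) ≠ 0` [cite: Kovacevic2021, §3 Thm 3 (b85), Remark 6] -/
theorem principalSeries_step_A {p q : ℤ} (hp : 0 ≤ p) (hq : 0 ≤ q) (ha : acoef c t p ≠ 0) :
    (principalSeries c t).Step Dir.A (1 + p + q, 2 * t + 3 * p - 3 * q)
      (1 + (p + 1) + q, 2 * t + 3 * (p + 1) - 3 * q) :=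
  ⟨mem_cone hp hq rfl rfl, mem_cone (by omega) hq rfl rfl, by simp only [Dir.shift, Prod.mk.injEq]; omega,
    (principalSeries_A_ne_zero_iff c t hp hq).2 ha⟩

/-- the live `B`-step `(p,q) → (p,q+1)` of `V(c,2t)` when `b(q) ≠ 0` [cite: Kovacevic2021, §3 Thm 3 (b90), Remark 6] -/
theorem principalSeries_step_B {p q : ℤ} (hp : 0 ≤ p) (hq : 0 ≤ q) (hb : bcoef c t q ≠ 0) :
    (principalSeries c t).Step Dir.B (1 + p + q, 2 * t + 3 * p - 3 * q)
      (1 + p + (q + 1), 2 * t + 3 * p - 3 * (q + 1)) :=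
  ⟨mem_cone hp hq rfl rfl, mem_cone hp (by omega) rfl rfl, by simp only [Dir.shift, Prod.mk.injEq]; omega,
    (principalSeries_B_ne_zero_iff c t hp hq).2 hb⟩

/-- the live `C`-step `(p,q+1) → (p,q)` of `V(c,2t)` (always live) [cite: Kovacevic2021, §3 Thm 3 (b95)] -/
theorem principalSeries_step_C {p q : ℤ} (hp : 0 ≤ p) (hq : 0 ≤ q) :
    (principalSeries c t).Step Dir.C (1 + p + (q + 1), 2 * t + 3 * p - 3 * (q + 1))
      (1 + p + q, 2 * t + 3 * p - 3 * q) :=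
  ⟨mem_cone hp (by omega) rfl rfl, mem_cone hp hq rfl rfl, by simp only [Dir.shift, Prod.mk.injEq]; omega,
    (principalSeries_C_ne_zero_iff c t hp (by omega : (0 : ℤ) ≤ q + 1)).2 (by omega)⟩

/-- the live `D`-step `(p+1,q) → (p,q)` of `V(c,2t)` (always live) [cite: Kovacevic2021, §3 Thm 3 (b100)] -/
theorem principalSeries_step_D {p q : ℤ} (hp : 0 ≤ p) (hq : 0 ≤ q) :
    (principalSeries c t).Step Dir.D (1 + (p + 1) + q, 2 * t + 3 * (p + 1) - 3 * q)
      (1 + p + q, 2 * t + 3 * p - 3 * q) :=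
  ⟨mem_cone (by omega) hq rfl rfl, mem_cone hp hq rfl rfl, by simp only [Dir.shift, Prod.mk.injEq]; omega,
    (principalSeries_D_ne_zero_iff c t (by omega : (0 : ℤ) ≤ p + 1) hq).2 (by omega)⟩

/-! ## §2 Staircase walks inside a cell -/

section Walks

variable {c t} {𝒟' : SU21Datum} {T : Set (ℤ × ℤ)}
  (hstep : ∀ (δ : Dir) (a b : ℤ × ℤ), a ∈ T → b ∈ T → (principalSeries c t).Step δ a b → 𝒟'.Step δ a b)

include hstep

/-- **Walking up a row**: from `(p₁,q)` to `(p₂,q)`, `p₁ ≤ p₂`, by live `A`-steps, if the row segment lies in `T` and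
no `a(r)`, `p₁ ≤ r < p₂`, vanishes. [cite: Kovacevic2021, §3 proof of Thm 3] -/
theorem reach_row_up {q : ℤ} (hq : 0 ≤ q) {p₁ p₂ : ℤ} (hp₁ : 0 ≤ p₁) (h12 : p₁ ≤ p₂)
    (hT : ∀ r : ℤ, p₁ ≤ r → r ≤ p₂ → ((1 + r + q, 2 * t + 3 * r - 3 * q) : ℤ × ℤ) ∈ T)
    (hA : ∀ r : ℤ, p₁ ≤ r → r < p₂ → acoef c t r ≠ 0) :
    𝒟'.Reach (1 + p₁ + q, 2 * t + 3 * p₁ - 3 * q) (1 + p₂ + q, 2 * t + 3 * p₂ - 3 * q) := by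
  induction p₂, h12 using Int.leInduction with
  | base => exact Relation.ReflTransGen.refl
  | succ p₂ h12 ih =>
    refine Relation.ReflTransGen.tail (ih (fun r h1 h2 => hT r h1 (by omega)) fun r h1 h2 => hA r h1 (by omega))
      ⟨Dir.A, hstep _ _ _ (hT p₂ h12 (by omega)) (hT (p₂ + 1) (by omega) le_rfl) ?_⟩
    exact principalSeries_step_A c t (by omega) hq (hA p₂ h12 (by omega))

/-- **Walking down a row**: from `(p₁,q)` to `(p₂,q)`, `p₂ ≤ p₁`, by live `D`-steps (always live), if the row segment
lies in `T`. [cite: Kovacevic2021, §3 proof of Thm 3] -/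
theorem reach_row_down {q : ℤ} (hq : 0 ≤ q) {p₁ p₂ : ℤ} (hp₂ : 0 ≤ p₂) (h21 : p₂ ≤ p₁)
    (hT : ∀ r : ℤ, p₂ ≤ r → r ≤ p₁ → ((1 + r + q, 2 * t + 3 * r - 3 * q) : ℤ × ℤ) ∈ T) :
    𝒟'.Reach (1 + p₁ + q, 2 * t + 3 * p₁ - 3 * q) (1 + p₂ + q, 2 * t + 3 * p₂ - 3 * q) := by
  induction p₁, h21 using Int.leInduction with
  | base => exact Relation.ReflTransGen.refl
  | succ p₁ h21 ih =>
    refine Relation.ReflTransGen.head ⟨Dir.D, hstep _ _ _ (hT (p₁ + 1) (by omega) le_rfl) (hT p₁ h21 (by omega)) ?_⟩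
      (ih fun r h1 h2 => hT r h1 (by omega))
    exact principalSeries_step_D c t (by omega) hq

/-- **Walking up a column**: from `(p,q₁)` to `(p,q₂)`, `q₁ ≤ q₂`, by live `B`-steps, if the column segment lies in
`T` and no `b(s)`, `q₁ ≤ s < q₂`, vanishes. [cite: Kovacevic2021, §3 proof of Thm 3] -/
theorem reach_col_up {p : ℤ} (hp : 0 ≤ p) {q₁ q₂ : ℤ} (hq₁ : 0 ≤ q₁) (h12 : q₁ ≤ q₂)
    (hT : ∀ s : ℤ, q₁ ≤ s → s ≤ q₂ → ((1 + p + s, 2 * t + 3 * p - 3 * s) : ℤ × ℤ) ∈ T)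
    (hB : ∀ s : ℤ, q₁ ≤ s → s < q₂ → bcoef c t s ≠ 0) :
    𝒟'.Reach (1 + p + q₁, 2 * t + 3 * p - 3 * q₁) (1 + p + q₂, 2 * t + 3 * p - 3 * q₂) := by
  induction q₂, h12 using Int.leInduction with
  | base => exact Relation.ReflTransGen.refl
  | succ q₂ h12 ih =>
    refine Relation.ReflTransGen.tail (ih (fun s h1 h2 => hT s h1 (by omega)) fun s h1 h2 => hB s h1 (by omega))
      ⟨Dir.B, hstep _ _ _ (hT q₂ h12 (by omega)) (hT (q₂ + 1) (by omega) le_rfl) ?_⟩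
    exact principalSeries_step_B c t hp (by omega) (hB q₂ h12 (by omega))

/-- **Walking down a column**: from `(p,q₁)` to `(p,q₂)`, `q₂ ≤ q₁`, by live `C`-steps (always live), if the column
segment lies in `T`. [cite: Kovacevic2021, §3 proof of Thm 3] -/
theorem reach_col_down {p : ℤ} (hp : 0 ≤ p) {q₁ q₂ : ℤ} (hq₂ : 0 ≤ q₂) (h21 : q₂ ≤ q₁)
    (hT : ∀ s : ℤ, q₂ ≤ s → s ≤ q₁ → ((1 + p + s, 2 * t + 3 * p - 3 * s) : ℤ × ℤ) ∈ T) :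
    𝒟'.Reach (1 + p + q₁, 2 * t + 3 * p - 3 * q₁) (1 + p + q₂, 2 * t + 3 * p - 3 * q₂) := by
  induction q₁, h21 using Int.leInduction with
  | base => exact Relation.ReflTransGen.refl
  | succ q₁ h21 ih =>
    refine Relation.ReflTransGen.head ⟨Dir.C, hstep _ _ _ (hT (q₁ + 1) (by omega) le_rfl) (hT q₁ h21 (by omega)) ?_⟩
      (ih fun s h1 h2 => hT s h1 (by omega))
    exact principalSeries_step_C c t hp (by omega)

/-- **Any two `K`-types of a product cell are joined by a live staircase walk inside the cell.** Let `I, J ⊆ ℤ_{≥0}`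
be order-connected, suppose the cell `{V_{1+p+q, 2t+3p−3q} : p ∈ I, q ∈ J}` lies in `T`, no `a(p)` vanishes for
`p, p+1 ∈ I` and no `b(q)` for `q, q+1 ∈ J`.  Then every live step of `V(c,2t)` used by the walk
"row first, then column" stays in `T`, so the walk is a live walk of `𝒟'`.
[cite: Kovacevic2021, §3 proof of Thm 3 ("cone / strip / parallelogram", "walk from one vertex to another")] -/
theorem reach_of_cell {I J : Set ℤ} (hI : I.OrdConnected) (hJ : J.OrdConnected) (hI0 : ∀ p ∈ I, 0 ≤ p)
    (hJ0 : ∀ q ∈ J, 0 ≤ q) (hT : ∀ p ∈ I, ∀ q ∈ J, ((1 + p + q, 2 * t + 3 * p - 3 * q) : ℤ × ℤ) ∈ T)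
    (hA : ∀ p ∈ I, p + 1 ∈ I → acoef c t p ≠ 0) (hB : ∀ q ∈ J, q + 1 ∈ J → bcoef c t q ≠ 0)
    {p₁ q₁ p₂ q₂ : ℤ} (hp₁ : p₁ ∈ I) (hq₁ : q₁ ∈ J) (hp₂ : p₂ ∈ I) (hq₂ : q₂ ∈ J) :
    𝒟'.Reach (1 + p₁ + q₁, 2 * t + 3 * p₁ - 3 * q₁) (1 + p₂ + q₂, 2 * t + 3 * p₂ - 3 * q₂) := by
  -- the row from `(p₁,q₁)` to `(p₂,q₁)`
  have hrow : 𝒟'.Reach (1 + p₁ + q₁, 2 * t + 3 * p₁ - 3 * q₁) (1 + p₂ + q₁, 2 * t + 3 * p₂ - 3 * q₁) := by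
    rcases le_total p₁ p₂ with h | h
    · have hmem : ∀ r : ℤ, p₁ ≤ r → r ≤ p₂ → r ∈ I := fun r h1 h2 => hI.out hp₁ hp₂ ⟨h1, h2⟩
      exact reach_row_up hstep (hJ0 q₁ hq₁) (hI0 p₁ hp₁) h (fun r h1 h2 => hT r (hmem r h1 h2) q₁ hq₁)
        fun r h1 h2 => hA r (hmem r h1 h2.le) (hmem (r + 1) (by omega) (by omega))
    · have hmem : ∀ r : ℤ, p₂ ≤ r → r ≤ p₁ → r ∈ I := fun r h1 h2 => hI.out hp₂ hp₁ ⟨h1, h2⟩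
      exact reach_row_down hstep (hJ0 q₁ hq₁) (hI0 p₂ hp₂) h fun r h1 h2 => hT r (hmem r h1 h2) q₁ hq₁
  -- the column from `(p₂,q₁)` to `(p₂,q₂)`
  have hcol : 𝒟'.Reach (1 + p₂ + q₁, 2 * t + 3 * p₂ - 3 * q₁) (1 + p₂ + q₂, 2 * t + 3 * p₂ - 3 * q₂) := by
    rcases le_total q₁ q₂ with h | h
    · have hmem : ∀ s : ℤ, q₁ ≤ s → s ≤ q₂ → s ∈ J := fun s h1 h2 => hJ.out hq₁ hq₂ ⟨h1, h2⟩
      exact reach_col_up hstep (hI0 p₂ hp₂) (hJ0 q₁ hq₁) h (fun s h1 h2 => hT p₂ hp₂ s (hmem s h1 h2))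
        fun s h1 h2 => hB s (hmem s h1 h2.le) (hmem (s + 1) (by omega) (by omega))
    · have hmem : ∀ s : ℤ, q₂ ≤ s → s ≤ q₁ → s ∈ J := fun s h1 h2 => hJ.out hq₂ hq₁ ⟨h1, h2⟩
      exact reach_col_down hstep (hI0 p₂ hp₂) (hJ0 q₂ hq₂) h fun s h1 h2 => hT p₂ hp₂ s (hmem s h1 h2)
  exact hrow.trans hcol

end Walks

/-! ## §3 The Casimir vanishes at the cohomological points -/

/-- **On the parabola `4c + 2t²/3 = 0` (i.e. `6c + t² = 0`) the Casimir of `V(c,2t)` is `0`.**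
[cite: Kovacevic2021, §3 Thm 3, Remark 3] [cite: BorelWallach2000, II Cor. 3.3, VI 4.10] -/
theorem principalSeries_casimir_eq_zero (h : 4 * c + 2 * (t : ℂ) ^ 2 / 3 = 0) : (principalSeries c t).casimir = 0 := by
  rw [casimir_principalSeries, h, zero_smul]

/-- on the parabola the Casimir SCALAR of `V(c,2t)` vanishes on every `K`-type [cite: Kovacevic2021, §3 Thm 3, Remark 3] -/
theorem principalSeries_casimirScalar_eq_zero (h : 4 * c + 2 * (t : ℂ) ^ 2 / 3 = 0) {n m : ℤ}
    (hS : (n, m) ∈ (principalSeries c t).S) : (principalSeries c t).casimirScalar n m = 0 :=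
  casimirScalar_eq_zero_of_casimir_eq_zero (principalSeries_casimir_eq_zero c t h) hS

/-- `V(0,0)` has Casimir scalar `0` on its `K`-types [cite: BorelWallach2000, VI 4.10 (10)] [cite: Kovacevic2021, §4] -/
theorem principalSeries_zero_zero_casimirScalar {n m : ℤ} (hS : (n, m) ∈ (principalSeries 0 0).S) :
    (principalSeries 0 0).casimirScalar n m = 0 :=
  principalSeries_casimirScalar_eq_zero 0 0 (by norm_num) hS

/-- `V(−3/2,6)` has Casimir scalar `0` on its `K`-types [cite: BorelWallach2000, VI 4.10 (10)] [cite: Kovacevic2021, §4] -/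
theorem principalSeries_hol_casimirScalar {n m : ℤ} (hS : (n, m) ∈ (principalSeries (-3 / 2) 3).S) :
    (principalSeries (-3 / 2) 3).casimirScalar n m = 0 :=
  principalSeries_casimirScalar_eq_zero _ 3 (by norm_num) hS

/-- `V(−3/2,−6)` has Casimir scalar `0` on its `K`-types [cite: BorelWallach2000, VI 4.10 (10)] [cite: Kovacevic2021, §4] -/
theorem principalSeries_antihol_casimirScalar {n m : ℤ} (hS : (n, m) ∈ (principalSeries (-3 / 2) (-3)).S) :
    (principalSeries (-3 / 2) (-3)).casimirScalar n m = 0 :=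
  principalSeries_casimirScalar_eq_zero _ (-3) (by norm_num) hS

end SU21Datum

end Literature.RepresentationTheory.Kovacevic2021
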